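/-
Origin: expansion seat `planner-pub-hodgecm-pv15-g6-0`, handover import Pv15g6.KernelModelHeisenbergPair -> import HodgeCM.Automorphic.KernelModelHeisenbergPair ; after KernelModelHeisenbergPair.lean (row 1, e3aeb2da88a084ef4c0c607074361185) ; new (CLAIM #2 14:57:53Z at e60cd964; handed bytes = CLAIM bytes + 2 docstrings + dummy character binders dropped from ϑcSwap_ne_zero, ϑc_ne_zero'; additive leaf, nothing imports it) (`HOME/pub-hodgecm-pv15-g6/lean/Pv15g6/KernelModelHeisenbergPairSeesaw.lean`, md5 84267bd2, 464 lines);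
landed by the gen-8 packager in gate run 31 as `HodgeCM/Automorphic/KernelModelHeisenbergPairSeesaw.lean` (import ^import Pv15g6\.KernelModelHeisenbergPair[ \t]*$→import HodgeCM.Automorphic.KernelModelHeisenbergPair ×1).
-/
/-
Copyright: HodgeCM PerL speedrun cell `pub-hodgecm`, seat pv15-g6 (DAG-node prover #15, gen 6), 2026-08-18.
WIP path `HOME/pub-hodgecm-pv15-g6/lean/Pv15g6/KernelModelHeisenbergPairSeesaw.lean`;
target `HodgeCM/Automorphic/KernelModelHeisenbergPairSeesaw.lean` (ONE NEW FILE, additive KERNEL leaf: nothing landed is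
edited, nothing imports it).  Imports `KernelModelHeisenbergPair` only (the WIP import of that sibling module, library `Pv15g6`, becomes
`import HodgeCM.Automorphic.KernelModelHeisenbergPair` at landing).
-/
import Summits.HodgeConjecture.HodgeCM.Automorphic.KernelModelHeisenbergPair_3

/-!
# The SEESAW IDENTITY of the Heisenberg dual-pair kernel model, and non-vanishing of the doubly-toric period

In the two-variable kernel model of `KernelModelHeisenbergPair` (`θ_Φ` on `[Heis K] × [Heis Kᗮ]`, `V = K ⊕ Kᗮ`,
`L = L₁ ⊕ L₂`, weight `m ≠ 0`) BOTH factors carry a Schrödinger torus with a compactly supported cutoff (`β K L₁ m`,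
`β Kᗮ L₂ m`, pv15-g5) and allowed characters `ξ₁ ∈ Xw K L₁ m`, `ξ₂ ∈ Xw Kᗮ L₂ m`; §§5–7 of the pair file constructed the
toric-period functionals of both theta lifts (`torusCarrier`, `torusCarrierSwap`).  This file proves:

* §1 `θ_pt_pt` — the kernel on the product torus: `θ_Φ(pt₁ t₁, pt₂ t₂) = (u₁u₂)ᵐ Σ_{v ∈ L} Φ(v − (a₁ + a₂))`.
* §2 the DOUBLY-TORIC INTEGRAND `β₁ξ₁ ⊗ β₂ξ₂ · θ_Φ ∘ (pt₁ × pt₂)` on `T₁(𝔸) × T₂(𝔸)` — continuous, compactly supported,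
  integrable for `haar × haar`; the DOUBLY-TORIC PERIOD `doublePeriod ξ₁ ξ₂ Φ := ∫_{T₁} β₁ξ₁ · (ϑ_{T₂,ξ₂}(Φ) ∘ pt₁) dν₁`
  (the `T₁`-toric period of the `T₂`-toric-period FUNCTION `ϑ_{T₂,ξ₂}(Φ) ∈ C([Heis K])`), and the **SEESAW IDENTITY**
  `seesaw : doublePeriod ξ₁ ξ₂ Φ = ∫_{T₂} β₂ξ₂ · (ϑ^{swap}_{T₁,ξ₁}(Φ) ∘ pt₂) dν₂` — the `T₂`-toric period of the SWAPPED
  model's `T₁`-toric-period function `ϑ^{swap}_{T₁,ξ₁}(Φ) ∈ C([Heis Kᗮ])` — from the transposed kernel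
  (`pairModelSwap_θ_swap`) and Fubini.
* §3 `doublePeriod_eq` — the explicit value `∫∫ β₁(t₁)β₂(t₂) ξ₁(a₁,1) ξ₂(a₂,1) Σ_{v ∈ L} Φ(v − (a₁ + a₂))` (the central
  weights cancel) — and **`doublePeriod_ne_zero`: for EVERY pair of allowed characters some Schwartz `Φ` has
  `doublePeriod ξ₁ ξ₂ Φ ≠ 0`** (a bump at `a₁⁰ + a₂⁰` below the continuity moduli of both phases; the orthogonality
  lemmas `norm_le_norm_add_of_mem(')` localise BOTH lattice components of a near vector at once).
* §4 corollaries through the seesaw: `ϑcSwap_ne_zero` — for every `ξ₁` some `Φ` has `ϑ^{swap}_{T₁,ξ₁}(Φ) ≠ 0` in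
  `C([Heis Kᗮ])` (a vanishing inner period function kills the double period) — and the symmetric `ϑc_ne_zero'`.

HONEST SCOPE as in the pair file: archimedean shadow with `ψ = 𝐞`; PerL's adelic seesaw (similitude theta,
`GU(1,1)_E ← GU(W)`, eq. `(seesaw)` of §4 Step 1) is NOT formalised here — this is the two-torus Fubini exchange in the
kernel model with both toric sides CONSTRUCTED.  Everything is proved; nothing is cited; no PerL / QW8 / 2001 statement
is used; axioms ⊆ {propext, Classical.choice, Quot.sound}.
-/

set_option autoImplicit false

noncomputable section

open MeasureTheory Topology
open HodgeCM.PerL34 HodgeCM.PerL34.Annihilation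

open scoped RealInnerProductSpace FourierTransform SchwartzMap CompactlySupported

attribute [-instance] Quotient.instMeasurableSpace

namespace HodgeCM
namespace SchwartzWeil
namespace HeisenbergPair

open HeisenbergKernel

attribute [local instance] borelCircle borelSpace_circle borelT borelSpace_T

variable (V : Type) [NormedAddCommGroup V] [InnerProductSpace ℝ V] [FiniteDimensional ℝ V] [MeasurableSpace V]
  [BorelSpace V] (K : Submodule ℝ V) (L₁ : Submodule ℤ K) [DiscreteTopology L₁] [IsZLattice ℝ L₁]
  (L₂ : Submodule ℤ Kᗮ) [DiscreteTopology L₂] [IsZLattice ℝ L₂] (m : ℤ) [NeZero m]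

/-! ## 1. The kernel on the product torus -/

/-- `θ_Φ(pt₁ t₁, pt₂ t₂) = (u₁u₂)ᵐ Σ_{v ∈ L} Φ(v − (a₁ + a₂))` for `tᵢ = (aᵢ, uᵢ)`. -/
theorem θ_pt_pt (Φ : 𝓢(V, ℂ)) (t₁ : Multiplicative K × Circle) (t₂ : Multiplicative Kᗮ × Circle) :
    (core V K L₁ L₂ m).θ ⟨Φ, Set.mem_univ Φ⟩
        ((torusCarrierSwap V K L₁ L₂ m).pt t₁, (torusCarrier V K L₁ L₂ m).pt t₂) =
      ((t₁.2 : ℂ) * (t₂.2 : ℂ)) ^ m *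
        ∑' v : lat V K L₁ L₂, Φ ((v : V) -
          (((Multiplicative.toAdd t₁.1 : K) : V) + ((Multiplicative.toAdd t₂.1 : Kᗮ) : V))) := by
  have h : (core V K L₁ L₂ m).θ ⟨Φ, Set.mem_univ Φ⟩
        ((torusCarrierSwap V K L₁ L₂ m).pt t₁, (torusCarrier V K L₁ L₂ m).pt t₂) =
      thetaH V (lat V K L₁ L₂) m Φ (incl₁ V K (Heis.ofSchrodinger t₁) * incl₂ V K (Heis.ofSchrodinger t₂)) := by
    have h' := θ_pt V K L₁ L₂ m Φ (Heis.ofSchrodinger t₁)⁻¹ t₂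
    rw [inv_inv] at h'
    exact h'
  rw [h, thetaH_eq]
  simp only [Heis.mul_a, Heis.mul_b, Heis.mul_u, incl₁_a, incl₁_b, incl₁_u,
    Heis.ofSchrodinger_a, Heis.ofSchrodinger_b, Heis.ofSchrodinger_u, Submodule.coe_zero, add_zero, smul_zero,
    inner_zero_left, inner_zero_right, neg_zero, AddChar.map_zero_eq_one, mul_one, Circle.coe_one, one_mul,
    Circle.coe_mul]

/-! ## 2. The doubly-toric integrand, the doubly-toric period, and the seesaw identity -/

/-- The doubly-toric integrand `(t₁, t₂) ↦ β₁(t₁)β₂(t₂) · ξ₁(t₁Λ₁)ξ₂(t₂Λ₂) · θ_Φ(pt₁ t₁, pt₂ t₂)`. -/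
def integrand (χ₁ : Xw K L₁ m) (χ₂ : Xw Kᗮ L₂ m) (Φ : 𝓢(V, ℂ))
    (p : (Multiplicative K × Circle) × (Multiplicative Kᗮ × Circle)) : ℂ :=
  ((β K L₁ m p.1 : ℂ) * (β Kᗮ L₂ m p.2 : ℂ)) *
    (dualChar χ₁.1 (QuotientGroup.mk p.1 : (Multiplicative K × Circle) ⧸ ΛT K L₁ m) *
      dualChar χ₂.1 (QuotientGroup.mk p.2 : (Multiplicative Kᗮ × Circle) ⧸ ΛT Kᗮ L₂ m) *
        (core V K L₁ L₂ m).θ ⟨Φ, Set.mem_univ Φ⟩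
          ((torusCarrierSwap V K L₁ L₂ m).pt p.1, (torusCarrier V K L₁ L₂ m).pt p.2))

omit [MeasurableSpace V] [BorelSpace V] in
/-- The cutoff `β₁ ⊗ β₂` is compactly supported on `T₁(𝔸) × T₂(𝔸)` (complex-valued version). -/
theorem hasCompactSupport_ββ : HasCompactSupport
    fun p : (Multiplicative K × Circle) × (Multiplicative Kᗮ × Circle) => (β K L₁ m p.1 : ℂ) * (β Kᗮ L₂ m p.2 : ℂ) := by
  refine HasCompactSupport.intro ((β K L₁ m).hasCompactSupport.prod (β Kᗮ L₂ m).hasCompactSupport) fun p hp => ?_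
  rw [Set.mem_prod, not_and_or] at hp
  rcases hp with h | h
  · rw [image_eq_zero_of_notMem_tsupport h, Complex.ofReal_zero, zero_mul]
  · rw [image_eq_zero_of_notMem_tsupport h, Complex.ofReal_zero, mul_zero]

omit [MeasurableSpace V] [BorelSpace V] in
/-- … and the real-valued version. -/
theorem hasCompactSupport_ββ_real : HasCompactSupport
    fun p : (Multiplicative K × Circle) × (Multiplicative Kᗮ × Circle) => β K L₁ m p.1 * β Kᗮ L₂ m p.2 := by
  refine HasCompactSupport.intro ((β K L₁ m).hasCompactSupport.prod (β Kᗮ L₂ m).hasCompactSupport) fun p hp => ?_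
  rw [Set.mem_prod, not_and_or] at hp
  rcases hp with h | h
  · rw [image_eq_zero_of_notMem_tsupport h, zero_mul]
  · rw [image_eq_zero_of_notMem_tsupport h, mul_zero]

/-- The doubly-toric integrand is continuous (products of continuous maps; the kernel `θ_Φ` is a
continuous function on `[Heis K] × [Heis Kᗮ]` and `pt₁`, `pt₂` are continuous). -/
theorem continuous_integrand (χ₁ : Xw K L₁ m) (χ₂ : Xw Kᗮ L₂ m) (Φ : 𝓢(V, ℂ)) :
    Continuous (integrand V K L₁ L₂ m χ₁ χ₂ Φ) := by
  unfold integrand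
  refine (((Complex.continuous_ofReal.comp ((β K L₁ m).continuous.comp continuous_fst)).mul
    (Complex.continuous_ofReal.comp ((β Kᗮ L₂ m).continuous.comp continuous_snd))).mul
      ((((continuous_dualChar χ₁.1).comp (QuotientGroup.continuous_mk.comp continuous_fst)).mul
        ((continuous_dualChar χ₂.1).comp (QuotientGroup.continuous_mk.comp continuous_snd))).mul
          (((core V K L₁ L₂ m).θ ⟨Φ, Set.mem_univ Φ⟩).continuous.comp
            (((torusCarrierSwap V K L₁ L₂ m).continuous_pt.comp continuous_fst).prodMk
              ((torusCarrier V K L₁ L₂ m).continuous_pt.comp continuous_snd)))))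

/-- The doubly-toric integrand is compactly supported: it carries the factor `β₁ ⊗ β₂`
(`hasCompactSupport_ββ`). -/
theorem hasCompactSupport_integrand (χ₁ : Xw K L₁ m) (χ₂ : Xw Kᗮ L₂ m) (Φ : 𝓢(V, ℂ)) :
    HasCompactSupport (integrand V K L₁ L₂ m χ₁ χ₂ Φ) := by
  unfold integrand
  exact (hasCompactSupport_ββ V K L₁ L₂ m).mul_right

/-- The doubly-toric integrand is integrable for `haar × haar` on `T₁(𝔸) × T₂(𝔸)`. -/
theorem integrable_integrand (χ₁ : Xw K L₁ m) (χ₂ : Xw Kᗮ L₂ m) (Φ : 𝓢(V, ℂ)) :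
    Integrable (integrand V K L₁ L₂ m χ₁ χ₂ Φ)
      ((Measure.haar : Measure (Multiplicative K × Circle)).prod
        (Measure.haar : Measure (Multiplicative Kᗮ × Circle))) :=
  (continuous_integrand V K L₁ L₂ m χ₁ χ₂ Φ).integrable_of_hasCompactSupport
    (hasCompactSupport_integrand V K L₁ L₂ m χ₁ χ₂ Φ)

/-- **The doubly-toric period** `P(ξ₁, ξ₂; Φ) := ∫_{T₁(𝔸)} β₁(t₁) ξ₁(t₁Λ₁) · ϑ_{T₂,ξ₂}(Φ)(pt₁ t₁) dν₁(t₁)`: the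
`T₁`-toric period (cutoff `β₁`, character `ξ₁`) of the `T₂`-toric-period FUNCTION `ϑ_{T₂,ξ₂}(Φ) ∈ C([Heis K])` of
the pair model. -/
def doublePeriod (χ₁ : Xw K L₁ m) (χ₂ : Xw Kᗮ L₂ m) (Φ : 𝓢(V, ℂ)) : ℂ :=
  ∫ t₁ : Multiplicative K × Circle,
    (β K L₁ m t₁ : ℂ) * dualChar χ₁.1 (QuotientGroup.mk t₁ : (Multiplicative K × Circle) ⧸ ΛT K L₁ m) *
      (torusCarrier V K L₁ L₂ m).ϑc χ₂ ⟨Φ, Set.mem_univ Φ⟩ ((torusCarrierSwap V K L₁ L₂ m).pt t₁) ∂Measure.haar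

/-- The doubly-toric period as an iterated integral of the doubly-toric integrand (`T₁` outside). -/
theorem doublePeriod_eq_integral_integral (χ₁ : Xw K L₁ m) (χ₂ : Xw Kᗮ L₂ m) (Φ : 𝓢(V, ℂ)) :
    doublePeriod V K L₁ L₂ m χ₁ χ₂ Φ =
      ∫ t₁ : Multiplicative K × Circle, ∫ t₂ : Multiplicative Kᗮ × Circle,
        integrand V K L₁ L₂ m χ₁ χ₂ Φ (t₁, t₂) ∂Measure.haar ∂Measure.haar := by
  unfold doublePeriod
  refine integral_congr_ae (Filter.Eventually.of_forall fun t₁ => ?_)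
  dsimp only
  rw [KernelTorusCarrier.ϑc_apply, torusCarrier_ν, ← integral_const_mul]
  refine integral_congr_ae (Filter.Eventually.of_forall fun t₂ => ?_)
  unfold integrand
  change (β K L₁ m t₁ : ℂ) * dualChar χ₁.1 (QuotientGroup.mk t₁ : (Multiplicative K × Circle) ⧸ ΛT K L₁ m) *
      ((β Kᗮ L₂ m t₂ : ℂ) * dualChar χ₂.1 (QuotientGroup.mk t₂ : (Multiplicative Kᗮ × Circle) ⧸ ΛT Kᗮ L₂ m) *
        (core V K L₁ L₂ m).θ ⟨Φ, Set.mem_univ Φ⟩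
          ((torusCarrierSwap V K L₁ L₂ m).pt t₁, (torusCarrier V K L₁ L₂ m).pt t₂)) = _
  ring

/-- The other toric-period-of-a-toric-period (`T₂` outside, the SWAPPED model's `T₁`-period function inside) as an
iterated integral of the SAME integrand — by the transposed kernel `pairModelSwap_θ_swap`. -/
theorem swapPeriod_eq_integral_integral (χ₁ : Xw K L₁ m) (χ₂ : Xw Kᗮ L₂ m) (Φ : 𝓢(V, ℂ)) :
    (∫ t₂ : Multiplicative Kᗮ × Circle,
      (β Kᗮ L₂ m t₂ : ℂ) * dualChar χ₂.1 (QuotientGroup.mk t₂ : (Multiplicative Kᗮ × Circle) ⧸ ΛT Kᗮ L₂ m) *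
        (torusCarrierSwap V K L₁ L₂ m).ϑc χ₁ ⟨Φ, Set.mem_univ Φ⟩ ((torusCarrier V K L₁ L₂ m).pt t₂) ∂Measure.haar) =
      ∫ t₂ : Multiplicative Kᗮ × Circle, ∫ t₁ : Multiplicative K × Circle,
        integrand V K L₁ L₂ m χ₁ χ₂ Φ (t₁, t₂) ∂Measure.haar ∂Measure.haar := by
  refine integral_congr_ae (Filter.Eventually.of_forall fun t₂ => ?_)
  dsimp only
  rw [KernelTorusCarrier.ϑc_apply, torusCarrierSwap_ν, ← integral_const_mul]
  refine integral_congr_ae (Filter.Eventually.of_forall fun t₁ => ?_)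
  have hs : (coreSwap V K L₁ L₂ m).θ ⟨Φ, Set.mem_univ Φ⟩
        ((torusCarrier V K L₁ L₂ m).pt t₂, (torusCarrierSwap V K L₁ L₂ m).pt t₁) =
      (core V K L₁ L₂ m).θ ⟨Φ, Set.mem_univ Φ⟩
        ((torusCarrierSwap V K L₁ L₂ m).pt t₁, (torusCarrier V K L₁ L₂ m).pt t₂) :=
    pairModelSwap_θ_swap V K L₁ L₂ m Φ (Heis.ofSchrodinger t₁)⁻¹ (Heis.ofSchrodinger t₂)⁻¹
  unfold integrand
  change (β Kᗮ L₂ m t₂ : ℂ) * dualChar χ₂.1 (QuotientGroup.mk t₂ : (Multiplicative Kᗮ × Circle) ⧸ ΛT Kᗮ L₂ m) *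
      ((β K L₁ m t₁ : ℂ) * dualChar χ₁.1 (QuotientGroup.mk t₁ : (Multiplicative K × Circle) ⧸ ΛT K L₁ m) *
        (coreSwap V K L₁ L₂ m).θ ⟨Φ, Set.mem_univ Φ⟩
          ((torusCarrier V K L₁ L₂ m).pt t₂, (torusCarrierSwap V K L₁ L₂ m).pt t₁)) = _
  rw [hs]
  ring

/-- **THE SEESAW IDENTITY of the dual-pair kernel model.**  For every `ξ₁ ∈ Xw K L₁ m`, `ξ₂ ∈ Xw Kᗮ L₂ m` and
Schwartz `Φ`:
`∫_{T₁(𝔸)} β₁ξ₁ · ϑ_{T₂,ξ₂}(Φ) ∘ pt₁ dν₁ = ∫_{T₂(𝔸)} β₂ξ₂ · ϑ^{swap}_{T₁,ξ₁}(Φ) ∘ pt₂ dν₂`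
— the `T₁`-toric period of the theta lift's `T₂`-toric-period function equals the `T₂`-toric period of the SWAPPED
lift's `T₁`-toric-period function (transposed kernel + Fubini on `T₁(𝔸) × T₂(𝔸)`). -/
theorem seesaw (χ₁ : Xw K L₁ m) (χ₂ : Xw Kᗮ L₂ m) (Φ : 𝓢(V, ℂ)) :
    doublePeriod V K L₁ L₂ m χ₁ χ₂ Φ =
      ∫ t₂ : Multiplicative Kᗮ × Circle,
        (β Kᗮ L₂ m t₂ : ℂ) * dualChar χ₂.1 (QuotientGroup.mk t₂ : (Multiplicative Kᗮ × Circle) ⧸ ΛT Kᗮ L₂ m) *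
          (torusCarrierSwap V K L₁ L₂ m).ϑc χ₁ ⟨Φ, Set.mem_univ Φ⟩ ((torusCarrier V K L₁ L₂ m).pt t₂)
            ∂Measure.haar := by
  rw [doublePeriod_eq_integral_integral, swapPeriod_eq_integral_integral]
  exact integral_integral_swap (integrable_integrand V K L₁ L₂ m χ₁ χ₂ Φ)

/-- The doubly-toric period as ONE integral over `T₁(𝔸) × T₂(𝔸)` against `haar × haar`. -/
theorem doublePeriod_eq_integral_prod (χ₁ : Xw K L₁ m) (χ₂ : Xw Kᗮ L₂ m) (Φ : 𝓢(V, ℂ)) :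
    doublePeriod V K L₁ L₂ m χ₁ χ₂ Φ =
      ∫ p, integrand V K L₁ L₂ m χ₁ χ₂ Φ p ∂((Measure.haar : Measure (Multiplicative K × Circle)).prod
        (Measure.haar : Measure (Multiplicative Kᗮ × Circle))) := by
  rw [doublePeriod_eq_integral_integral,
    ← integral_prod (integrand V K L₁ L₂ m χ₁ χ₂ Φ) (integrable_integrand V K L₁ L₂ m χ₁ χ₂ Φ)]

/-! ## 3. The explicit value and NON-VANISHING of the doubly-toric period -/

/-- Pointwise, the central weights cancel:
`integrand(t₁, t₂) = β₁(t₁)β₂(t₂) · ξ₁(a₁, 1) ξ₂(a₂, 1) · Σ_{v ∈ L} Φ(v − (a₁ + a₂))`. -/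
theorem integrand_eq (χ₁ : Xw K L₁ m) (χ₂ : Xw Kᗮ L₂ m) (Φ : 𝓢(V, ℂ))
    (p : (Multiplicative K × Circle) × (Multiplicative Kᗮ × Circle)) :
    integrand V K L₁ L₂ m χ₁ χ₂ Φ p =
      ((β K L₁ m p.1 : ℂ) * (β Kᗮ L₂ m p.2 : ℂ)) *
        (dualChar χ₁.1 (QuotientGroup.mk (p.1.1, 1) : (Multiplicative K × Circle) ⧸ ΛT K L₁ m) *
          dualChar χ₂.1 (QuotientGroup.mk (p.2.1, 1) : (Multiplicative Kᗮ × Circle) ⧸ ΛT Kᗮ L₂ m) *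
            ∑' v : lat V K L₁ L₂, Φ ((v : V) -
              (((Multiplicative.toAdd p.1.1 : K) : V) + ((Multiplicative.toAdd p.2.1 : Kᗮ) : V)))) := by
  unfold integrand
  rw [θ_pt_pt, dualChar_mk_eq K L₁ m χ₁ p.1, dualChar_mk_eq Kᗮ L₂ m χ₂ p.2, Circle.coe_zpow, Circle.coe_zpow,
    zpow_neg, zpow_neg, mul_zpow]
  have hu₁ : ((p.1.2 : ℂ) ^ m) ≠ 0 := zpow_ne_zero m (Circle.coe_ne_zero _)
  have hu₂ : ((p.2.2 : ℂ) ^ m) ≠ 0 := zpow_ne_zero m (Circle.coe_ne_zero _)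
  have key : ∀ a b D₁ D₂ S x y : ℂ, x ≠ 0 → y ≠ 0 →
      a * b * (D₁ * x⁻¹ * (D₂ * y⁻¹) * (x * y * S)) = a * b * (D₁ * D₂ * S) := by
    intro a b D₁ D₂ S x y hx hy
    calc a * b * (D₁ * x⁻¹ * (D₂ * y⁻¹) * (x * y * S))
        = a * b * (D₁ * D₂ * S) * ((x⁻¹ * x) * (y⁻¹ * y)) := by ring
      _ = a * b * (D₁ * D₂ * S) := by rw [inv_mul_cancel₀ hx, inv_mul_cancel₀ hy, mul_one, mul_one]
  exact key _ _ _ _ _ _ _ hu₁ hu₂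

/-- **The explicit value**: `P(ξ₁, ξ₂; Φ) = ∫∫ β₁(t₁)β₂(t₂) ξ₁(a₁,1) ξ₂(a₂,1) Σ_{v ∈ L} Φ(v − (a₁ + a₂)) d(ν₁ × ν₂)`. -/
theorem doublePeriod_eq (χ₁ : Xw K L₁ m) (χ₂ : Xw Kᗮ L₂ m) (Φ : 𝓢(V, ℂ)) :
    doublePeriod V K L₁ L₂ m χ₁ χ₂ Φ =
      ∫ p, ((β K L₁ m p.1 : ℂ) * (β Kᗮ L₂ m p.2 : ℂ)) *
        (dualChar χ₁.1 (QuotientGroup.mk (p.1.1, 1) : (Multiplicative K × Circle) ⧸ ΛT K L₁ m) *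
          dualChar χ₂.1 (QuotientGroup.mk (p.2.1, 1) : (Multiplicative Kᗮ × Circle) ⧸ ΛT Kᗮ L₂ m) *
            ∑' v : lat V K L₁ L₂, Φ ((v : V) -
              (((Multiplicative.toAdd p.1.1 : K) : V) + ((Multiplicative.toAdd p.2.1 : Kᗮ) : V))))
        ∂((Measure.haar : Measure (Multiplicative K × Circle)).prod
          (Measure.haar : Measure (Multiplicative Kᗮ × Circle))) := by
  rw [doublePeriod_eq_integral_prod]
  exact integral_congr_ae (Filter.Eventually.of_forall fun p => integrand_eq V K L₁ L₂ m χ₁ χ₂ Φ p)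


-- port_pkg: scope closed for this part
end HeisenbergPair
end SchwartzWeil
end HodgeCM
end
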